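import Mathlib
import Literature.Dynamics.TopologicalDynamics.UniformRecurrence
import Literature.Analysis.FluidPDE.ScalingUniformRecurrence

/-!
# Sketch — crux-ideate round 2, ideator 5, crux `stmt-NavierStokesRegularity-1589` (RecurrentLiouville)

Typed form of the one place where uniform recurrence has teeth beyond compactness (see
`BarrierNotesIdeator5.md` §2): the **recurrence-upgrade lemma**. Along a uniformly recurrent
orbit, an almost-monotone functional with INTEGRABLE defect has defect identically zero on the
hull; "convergent + recurrent" becomes "constant on the hull". This is the bridge
`RecurrentLiouville ⟸ (class form of AdaptedFrequencyConverges) ∧ FrequencyRigidity`.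

Statements only (planner seat); `sorry` marks the proof obligations. Nothing here is an item.
-/

open Set Filter MeasureTheory
open Literature.Dynamics.TopologicalDynamics

namespace Summit.NavierStokesRegularity.NavierStokesRegularity.Cruxes.RecurrentLiouville.Ideator5

/-- **Recurrence upgrade (abstract).** Let `ϕ` be a jointly continuous `ℝ`-action on a compact
space, `x` a uniformly recurrent point, and `φ ≥ 0` a continuous observable whose forward
time-integral along the orbit of `x` is finite. Then `φ x = 0`.
Proof sketch: if `φ x > 0`, the superlevel set `{φ ≥ φ x / 2}` is compact, so by the tube lemma
there is `τ > 0` with `φ (ϕ h y) > φ x / 4` for `|h| < τ` and all such `y`; the return times of `x`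
to `{φ > φ x / 2}` are syndetic (window `L`), giving disjoint intervals of length `τ` in every
window of length `L + τ` on which the integrand exceeds `φ x / 4` — the integral diverges.
[folklore; Furstenberg 1981 Ch. 1 §4 for the recurrence notions] -/
theorem recurrenceUpgrade {X : Type*} [TopologicalSpace X] [CompactSpace X]
    (ϕ : ℝ → X → X) (hcont : Continuous fun p : ℝ × X => ϕ p.1 p.2)
    (hadd : ∀ s t y, ϕ (s + t) y = ϕ s (ϕ t y)) (h0 : ∀ y, ϕ 0 y = y)
    (φ : X → ℝ) (hφ : Continuous φ) (hφ0 : ∀ y, 0 ≤ φ y) (x : X)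
    (hrec : IsUniformlyRecurrentPt ϕ x)
    (hint : IntegrableOn (fun s => φ (ϕ s x)) (Ici 0)) : φ x = 0 := by
  sorry

/-- **Recurrence upgrade, orbit-closure form.** Under the same hypotheses `φ` vanishes on the
closure of the forward orbit (each `ϕ s x` is again uniformly recurrent with integrable tail, and
`φ` is continuous). For a uniformly recurrent point the forward-orbit closure is the whole
(minimal) orbit closure. [folklore] -/
theorem recurrenceUpgrade_closure {X : Type*} [TopologicalSpace X] [CompactSpace X]
    (ϕ : ℝ → X → X) (hcont : Continuous fun p : ℝ × X => ϕ p.1 p.2)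
    (hadd : ∀ s t y, ϕ (s + t) y = ϕ s (ϕ t y)) (h0 : ∀ y, ϕ 0 y = y)
    (φ : X → ℝ) (hφ : Continuous φ) (hφ0 : ∀ y, 0 ≤ φ y) (x : X)
    (hrec : IsUniformlyRecurrentPt ϕ x)
    (hint : IntegrableOn (fun s => φ (ϕ s x)) (Ici 0)) :
    ∀ y ∈ closure (range fun s : {s : ℝ // 0 ≤ s} => ϕ s x), φ y = 0 := by
  sorry

/-- **Convergent + recurrent ⇒ constant** (the form used by the AdaptedFrequency bridge): a
continuous observable that converges along a uniformly recurrent orbit is constant on the orbit,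
equal to its limit. [folklore] -/
theorem const_of_tendsto_of_recurrent {X : Type*} [TopologicalSpace X]
    (ϕ : ℝ → X → X) (hcont : Continuous fun p : ℝ × X => ϕ p.1 p.2)
    (hadd : ∀ s t y, ϕ (s + t) y = ϕ s (ϕ t y)) (h0 : ∀ y, ϕ 0 y = y)
    (φ : X → ℝ) (hφ : Continuous φ) (x : X) (hrec : IsUniformlyRecurrentPt ϕ x)
    (c : ℝ) (hlim : Tendsto (fun s => φ (ϕ s x)) atTop (nhds c)) :
    ∀ s : ℝ, φ (ϕ s x) = c := by
  sorry

end Summit.NavierStokesRegularity.NavierStokesRegularity.Cruxes.RecurrentLiouville.Ideator5
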